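import Mathlib
import HarnessLib
import HarnessLib.Audit
import Summits.ValiantsHypothesis.Statement
import Literature.Computability.AlgebraicComplexity.ArithCircuit
import Literature.Computability.AlgebraicComplexity.ConstantFreeValiant
import Literature.Computability.AlgebraicComplexity.ValiantClasses
import Literature.Computability.AlgebraicComplexity.BurgisserBooleanParts
import Literature.Computability.Complexity.CircuitComposition
import Literature.Computability.Complexity.Circuit
import Literature.Computability.Complexity.Nondeterministic
import Literature.Computability.Complexity.CircuitClasses

/-!
Route: NumTame

DORMANT since 2026-09-03T05:49:56Z (reconciler: no traction for 5 d (last activity statement-checked at 2026-08-29T05:05:32Z); parked, not closed — `ledger route dormant route-ValiantsHypothesis-NumTame --off` to reactivate) — unstaffed, not closed; items shared with open routes are served there. `ledger route dormant <id> --off` reactivates.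

# Route NumTame — Rounding instead of Riemann: tame normal forms give Bürgisser's Boolean transfer
without GRH

It suffices to show X = TameNF ∧ (NP ⊄ P/poly). TameNF (CUBE-TAME NORMAL FORM, card
archimedean-transfer-numtame made
non-collapsing): a fan-in-two circuit over ℂ computing a polynomial f in n variables with
coefficients of modulus ≤ 2^t and
degree d can be replaced, at size cost polynomial in N = size + n + t + d, by one computing the SAME
polynomial f whose constants,
sum weights and gate values at every 0/1 point have modulus ≤ 2^poly(N) ("no catastrophic magnitudes
are ever needed to compute a
small polynomial exactly"). Given the two theorem-level items TameA3 (rounding: cube-tame p-size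
circuits have FP/poly Boolean
parts, the archimedean, GRH-free twin of Bürgisser's (A3)) and CoeffBoundA2 ((A2) with coefficient
bounds), X ⇒ VP_ℂ ≠ VNP_ℂ.
Realises card archimedean-transfer-numtame (spine); MagnitudeNF / HeightNF are its algebraic and
arithmetic strengthenings.
Lean: `(∃ c : ℕ, ∀ (n t : ℕ) (f : MvPolynomial (Fin n) ℂ), (∀ m, ‖MvPolynomial.coeff m f‖ ≤ (2 : ℝ)
^ t) → ∀ P : Literature.Computability.AlgebraicComplexity.ArithCircuit ℂ (Fin n), P.IsFanInTwo →
P.Computes f → ∃ P' : Literature.Computability.AlgebraicComplexity.ArithCircuit ℂ (Fin n),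
P'.Computes f ∧ P'.size ≤ (P.size + n + t + f.totalDegree) ^ c + c ∧ P'.IsFanInTwo ∧ (∀ g ∈
P'.gates, ∀ u ∈ Literature.Computability.AlgebraicComplexity.ArithCircuit.Gate.args g, ∀ a : ℂ, u =
Literature.Computability.AlgebraicComplexity.ArithCircuit.Operand.const a → ‖a‖ ≤ (2 : ℝ) ^ ((P.size
+ n + t + f.totalDegree) ^ c + c)) ∧ (∀ args,
Literature.Computability.AlgebraicComplexity.ArithCircuit.Gate.sum args ∈ P'.gates → ∀ a ∈ args,
‖a.1‖ ≤ (2 : ℝ) ^ ((P.size + n + t + f.totalDegree) ^ c + c)) ∧ (∀ a : ℂ, P'.output =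
Literature.Computability.AlgebraicComplexity.ArithCircuit.Operand.const a → ‖a‖ ≤ (2 : ℝ) ^ ((P.size
+ n + t + f.totalDegree) ^ c + c)) ∧ ∀ g ∈
Literature.Computability.AlgebraicComplexity.ArithCircuit.gateValues P'.gates, ∀ x : Fin n → Bool,
‖MvPolynomial.eval (Literature.Computability.AlgebraicComplexity.boolPoint ℂ x) g‖ ≤ (2 : ℝ) ^
((P.size + n + t + f.totalDegree) ^ c + c)) ∧ ¬
(Literature.Computability.Complexity.Nondeterministic.NP ⊆
Literature.Computability.Complexity.PPoly)`

## Assembly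
By contradiction from VP ℂ = VNP ℂ: for L ∈ NP, CoeffBoundA2 gives a p-definable f with Boolean part
φ deciding L by positivity,
degree and coefficient bounds r(n); isVPFamily_of_VP_eq_VNP makes f p-computable,
ArithCircuit.exists_computes_holds + Nat.sInf_mem
give fan-in-two circuits of size complexity(f n); TameNF (with t := r n) gives cube-tame circuits of
p-bounded size computing f n
exactly, hence agreeing with φ on the cube (IsBooleanPart.eval_eq); TameA3 gives polynomial-size
B₂-circuits for the bits of φ;
positivity_mem_PPoly puts L in P/poly; BoolHyp is contradicted. IsPBounded closure lemmas
(add/mul/pow/comp _holds) only.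
DECIDING THEOREM (rev 1, D-0027 §2.1): `closes : TameNF → TameA3 → CoeffBoundA2 → BoolHyp → Assembly
→ ValiantsHypothesis`
(pure application, certified by the native audit); the Bürgisser-style bookkeeping above is the
content of the rank-1 statement
item `Assembly`, which provers prove in Theorems/ like any other item. BoolHyp is stated inline as ¬
(NP ⊆ P/poly)
(definitionally `Literature.Computability.Complexity.NPNotSubsetPPoly`, `Iff.rfl`), so the open
Boolean conjecture is this
route's own registered obligation and the dependency cone is otherwise proved down to Mathlib.

Rationale: WHY THIS LINE. Bürgisser's transfer VP_ℂ = VNP_ℂ ⇒ P/poly = NP/poly (Burgisser2000TCS Cor. 1.2(1),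
p. 74; book Burgisser2000 Thm 4.5) needs GRH at
exactly one step: a prime of polynomial bit-size with a residue-degree-ONE prime above it at which
the (re-solved, algebraic) circuit
constants are integral (TCS Thm 4.1/Cor 4.8, effective Chebotarev; tree:
rootModPrimeCount_lower_bound_of_GRH; p. 73: "replace
the complex constants by something discrete of small size"). At the archimedean place residue degree
one is free (K_σ = ℂ always)
and the only bill is MAGNITUDE (precision); forward error analysis of straight-line programs
(numerical analysis: Koiran's weak
model doi:10.1006/jcss.1997.1478, BlumCuckerShubSmale1998, AllenderEtAl PosSLP
doi:10.1137/070697926) replaces number theory. New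
here: (i) the observation that "tame circuits on the cube" as a HYPOTHESIS is equivalent to the
GRH-free Boolean-part conclusion
(Boolean circuits re-arithmetise tamely), so the honest non-collapsing crux is a NORMAL-FORM
statement for exact polynomial
computation (TameNF; its algebraic form MagnitudeNF = small constants + poly formal degree, the
issue named open in
KoiranPerifel2011 = arXiv:0710.0360 Rem. 4); (ii) the place dichotomy made into two GRH-free
theorems, TameA3 (infinite place)
and LowDegreeRegime (finite places: integral constants of p-bounded degree, any height). Imported
area: numerical analysis /
Diophantine geometry of heights (EmbeddingChoice = pigeonhole over conjugate embeddings). Differs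
from route BoolTransfer
(Chebotarev substitutes, characteristic transfer) and TauConst (integer constants, mod 2^ℓ):
tameness and τ are incomparable
hypotheses with the same Boolean pay-off. Negatives index: empty.

RANKED CRUXES. #0 Target (target) — X = TameNF ∧ NP ⊄ P/poly (both conjuncts spelled out; the
Boolean one as ¬ (Nondeterministic.NP ⊆ PPoly), definitionally
Literature.Computability.Complexity.NPNotSubsetPPoly). (why it might fail: TameNF may be false
(exact computation of some small-coefficient family could need doubly-exponential intermediate
magnitudes), and NP ⊆ P/poly contradicts nothing known (Karp–Lipton only collapses PH).)
[Burgisser2000TCS, arXiv:0710.0360, KarpLipton1980]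
#2 TameNF (crux) — cube-tame normal form: for some absolute c, every fan-in-two ℂ-circuit P
computing f (n variables, coefficients of modulus ≤ 2^t) can be replaced by a fan-in-two circuit
computing f of size ≤ N^c + c, N = |P| + n + t + deg f, all of whose constants, sum weights and gate
values at 0/1 points have modulus ≤ 2^(N^c + c) (card crux NumTame, exact-computation form).
[difficulty: open-problem] (why it might fail: A family f_n (poly size/degree, 0/1 coefficients)
whose every poly-size circuit must pass through cube-values 2^(2^(n^Ω(1))) ('cancellation is
essential') refutes it; no such phenomenon is known, but no magnitude-reduction theorem exists
either (KoiranPerifel2011 Rem. 4).) [arXiv:0710.0360, Burgisser2000TCS, doi:10.1006/jcss.1997.1478,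
Burgisser2009]
#3 TameA3 (crux) — archimedean (A3), GRH-free: if φ_n : {0,1}^n → ℕ, φ_n < 2^t(n), t p-bounded, is
computed on the cube by fan-in-two ℂ-circuits of p-bounded size r(n) whose constants, sum weights
and gate cube-values have modulus ≤ 2^r(n), then the bits of φ_n have polynomial-size B₂-circuits
(round a fixed-point simulation with O(r(n)·size) bits; constants become advice). [difficulty: L]
(why it might fail: Forward error analysis (ε_j ≤ (2^(R+2))^(j+1)·2^(-B)) settles it unless the
typed tameness misses a magnitude source — unbounded sum weights, output constant, or fan-in > 2
(all pinned in the Lean); formal cost: complex fixed-point arithmetic as B₂ programs.)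
[BlumCuckerShubSmale1998, doi:10.1137/070697926, doi:10.1137/s0097539794270340, Burgisser2000TCS]
#4 MagnitudeNF (crux) — magnitude normal form (algebraic strengthening of TameNF): same hypotheses,
and the new circuit has size and ALL gate formal degrees ≤ N^c + c and all constants / sum weights
of modulus ≤ 2^(N^c + c) (arbitrary complex constants allowed; only their size is bounded). Implies
TameNF by the growth lemma |g_j| ≤ 2^((R+1)·fdeg_j·(j+2)). [difficulty: open-problem] (why it might
fail: Large constants may genuinely help: KoiranPerifel2011 Rem. 4 ('integer constants of
exponential bit size') is open even for per; for a FIXED skeleton it is false (garbage gadgets force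
leaves y_(i+1) = y_i^D, |y_m| = 2^(D^m)), so any proof must restructure the circuit, not re-solve
its constants.) [arXiv:0710.0360, KrickPardo1996, Burgisser2000TCS, Koiran2004]
#9 MagnitudeGlue (support) — MagnitudeNF → TameNF: with fan-in two, constants and weights ≤ 2^R and
all gate formal degrees ≤ D, every gate value on the cube is ≤ 2^((R+1)·D·(s+2)) (induction over the
gate list). [difficulty: provable-now] [Burgisser2009, Burgisser2000]
#9 CoeffBoundA2 (support) — Bürgisser's (A2) over ℂ with bounds exported: every NP language has a
p-definable family with a Boolean part deciding it by positivity, whose degrees are ≤ r(n) and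
coefficients of modulus ≤ 2^r(n), r p-bounded (re-run Part II of BurgisserBooleanParts: products of
≤ poly EQ/table polynomials with O(1) coefficients). [difficulty: M] [Burgisser2000TCS,
Burgisser2000]
#9 BoolHyp (support) — NP ⊄ P/poly, stated inline as ¬ (Nondeterministic.NP ⊆ PPoly) (rev 1;
definitionally Literature.Computability.Complexity.NPNotSubsetPPoly by Iff.rfl — the OPEN conjecture
is registered as this route's own obligation per D-0027 instead of riding in as a cite-only
Literature IOU; same content as BoolTransfer's BoolHyp and PneNP's CircuitThesis; bookkeeping, not
expected to move here). [difficulty: open-problem] [CookClay2006, KarpLipton1980, Burgisser2000TCS]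
#9 EmbeddingChoice (support) — pigeonhole over conjugate embeddings (the 'Bilu/averaging' half of
the card, no equidistribution needed): if m elements of a number field K have archimedean height
products ∏_σ max(1,|σκ_j|) ≤ 2^(H·[K:ℚ]), some embedding σ : K → ℂ makes ALL |σ κ_j| ≤ 2^(mH+1);
with Galois-invariance of 'P computes f ∈ ℚ[x]' this turns poly-height constants of ANY degree into
small ones. [difficulty: provable-now] [doi:10.1215/S0012-7094-97-08921-3, Burgisser2000TCS]
#9 LowDegreeRegime (support) — the finite-place twin, GRH-free: if φ_n is computed on the cube by
fan-in-two ℂ-circuits of p-bounded size whose constants are algebraic INTEGERS lying in a subfield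
K_n ⊂ ℂ with [K_n:ℚ] ≤ r(n), then the bits of φ_n have polynomial-size circuits (simulate in O_K/𝔭 =
F_(p^f), f ≤ [K_n:ℚ], p a Bertrand prime > 2^t(n); residues are advice; no Chebotarev, heights
irrelevant; integrality is needed — a free constant 1/N with N divisible by all small primes kills
every small p). [difficulty: L] [Burgisser2000TCS, Burgisser2000, Koiran1996]

TWO-LAYER PLAN. TameNF ⇐ MagnitudeNF → MagnitudeGlue → TameNF (filed as support glue already);
MagnitudeNF ⇐ HeightNF (poly-height algebraic
constants of any degree + poly formal degrees; informal rank-5 crux) → EmbeddingChoice +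
Galois-conjugation of circuits → MagnitudeNF;
TameNF restricted to formulas / ABPs / skew circuits as first children (constants enter
multilinearly; small-solution questions
become linear-algebraic); TameA3 ⇐ FixedPointGates (B₂ programs for complex fixed-point +,×) →
ErrorRecursion → TameA3.

KILL CRITERIA. A family with poly size/degree and 0/1 coefficients whose every poly-size ℂ-circuit
needs cube-values of modulus 2^(2^(n^Ω(1)))
refutes TameNF (and MagnitudeNF): close `refuted:TameNF` — and record the witness as a new
structural phenomenon (essential
cancellation) for the constant problem. MagnitudeNF refuted alone ⇒ drop it, TameNF survives
(transcendental small constants /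
wild formal degree still allowed). NP ⊆ P/poly proved ⇒ route moot (as BoolTransfer). BoolGrhFree
(stmt-ValiantsHypothesis-0345)
or TauConstElim proved elsewhere ⇒ superseded for the summit, but TameNF/TameA3 keep independent
value.

NOT DECOMPOSED YET. HeightNF (stmt-ValiantsHypothesis-6383) is typed since open with the archimedean
height product over the embeddings K →+* ℂ standing in for the Weil height (Mathlib
Height.logHeight₁ is K-relative) and stays unranked support; the #P-version
(P^#P ⊄ P/poly suffices: TameA3 applied to counting families gives #P ⊆ FP/poly) is not typed — it
needs (A2) for #P with
coefficient bounds and BitGraphPPoly glue; quasi-polynomial variants (tameness 2^(n^polylog) vs NP ⊄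
SIZE(n^polylog)); the
polydisc-tame variant (sup over the unit polydisc, equivalent to coefficient + degree control of
every gate) sits between
MagnitudeNF and TameNF and is left out; uniform versions.

CHEAPEST FALSIFIER. For TameNF: search the literature / small cases for a polynomial with 0/1
coefficients and poly degree whose cheapest known
circuits use doubly-exponential magnitudes ESSENTIALLY (candidates: interpolation-based circuits
with nodes 2^(2^i); Strassen-type
division elimination at a far point; Chebyshev-like extremal polynomials) — one provable instance
kills the line. For TameA3: a
3-gate example where the typed tameness predicate holds but rounding fails would expose a missing
magnitude source (I checked sum
weights, const operands, output operand, fan-in: all pinned). Lookup: whether Koiran 1997 /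
Cucker–Grigoriev 1997 already state
BP of magnitude-bounded straight-line computation ⊆ P/poly (would make TameA3 'known', not false).

NUMBERS. Precision in TameA3: B = (R+2)(s+1)+10 fractional bits for size s and magnitude bound 2^R
(error ε_j ≤ (2^(R+2))^(j+1)·2^(-B) < 1/4);
Boolean cost O(s·(R+B)^2) = O(s^3 R^2). Growth lemma: |g_j| ≤ 2^((R+1)·D·(j+2)). EmbeddingChoice
threshold 2^(mH+1) for m constants
of height parameter H. GRH side for comparison: least prime with a degree-one prime above it ≪ (log
d_K)^2 under GRH vs d_L^O(1)
unconditionally (BoolTransfer crux 0345 sources). Items at open: 10 typed + 1 informal (HeightNF);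
rev 1: 11 typed items, deciding theorem `closes` (5 hypotheses: TameNF, TameA3, CoeffBoundA2,
BoolHyp, Assembly), import Literature.Computability.Complexity.ClayProblem dropped (NP, PPoly come
from Nondeterministic / CircuitClasses).

DEFINITION REQUESTS. None blocking: tameness is inlined over
Literature.Computability.AlgebraicComplexity.ArithCircuit (gates, Gate.args, Operand.const,
gateValues, gateFormalDegrees, boolPoint). Nice-to-have later: a named predicate
`ArithCircuit.IsCubeTame P R` in
Literature/Computability/AlgebraicComplexity abbreviating the five conjuncts (would shorten
TameNF/TameA3/MagnitudeNF).

Novelty: Searches (2026-08-15): `lit search --source zbmath "Interpolation in Valiant's theory"` (3;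
KoiranPerifel2011 found, arXiv:0710.0360 read, Rem. 4 p. 8 and §3.4); `lit search --source zbmath
"weak version Blum Shub Smale model Koiran"` (1: doi:10.1006/jcss.1997.1478); `lit search --source
zbmath "power of real Turing machines over binary inputs"` (1: doi:10.1137/s0097539794270340,
BP(PAR_R) = PSPACE/poly); `lit search --source zbmath "complexity of numerical analysis PosSLP"` (1:
doi:10.1137/070697926); `lit search --hybrid "Boolean part Valiant VP numerical precision rounding
GRH"` (10 local books, none relevant); `lit read paper:doi-10-1016-s0304-3975-99-00183-8 --grep
numeric|precision|archimed|round` (0 relevant hits; p. 73 'replace the complex constants by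
something discrete of small size'); `lit galaxy search "weak version of the Blum Shub Smale model
Boolean part P/poly" --star all` (service saturated, 0 rows); OpenAlex/S2/arXiv rate-limited (429)
this session; the card's own audit (Burgisser 2000/2024 greps, zbMATH) stands.
Nearest prior art found: Burgisser2000TCS (Thm 1.1/4.1, Cor 4.8: constants eliminated through F_p
under GRH; p. 73); KoiranPerifel2011 = arXiv:0710.0360 Rem. 4 (names the large-constants obstacle,
no archimedean approach); Koiran1997 weak BSS model doi:10.1006/jcss.1997.1478 and
CuckerGrigoriev1997 doi:10.1137/s0097539794270340 (Boolean parts of real straight-line/branching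
computation; cost models charging bit growth); AllenderEtAl2009 PosSLP doi:1  [refs: 10.1006/jcss.1997.1478, 10.1137/s0097539794270340, 10.1137/070697926, 0710.0360, doi:10.1006/jcss.1997.1478, doi:10.1137/s0097539794270340, doi:10.1137/070697926, paper:doi-10-1016-s0304-3975-99-00183-8, KoiranPerifel2011, Koiran1997, CuckerGrigoriev1997, AllenderEtAl2009]

Barriers (technique_class: boolean-transfer, numerical-simulation, magnitude-nf): - technique_class: boolean-transfer, numerical-simulation, magnitude-nf
- Literature.Barriers.ValiantsHypothesis.AlgebraicNaturalProofs: N/A — no distinguisher /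
lower-bound measure is proposed; the hard lower bound is imported from the Boolean side (NP ⊄
P/poly, with its own PneNP catalogue: natural proofs, relativization, algebrization), exactly as
route BoolTransfer records.
- Literature.Barriers.ValiantsHypothesis.PermanentCharTwo: N/A — characteristic 0 throughout;
LowDegreeRegime reduces modulo LARGE primes p > 2^t(n) only.
- Literature.Barriers.ValiantsHypothesis.TauRealZeros: N/A — no real-root counting; the
τ/constant-free line is route TauConst; tameness and τ-boundedness are incomparable hypotheses
(constant-free circuits may be wild: 2^(2^n) by squaring; tame circuits may use transcendental
constants).
- Literature.Barriers.ValiantsHypothesis.RankMethods: N/A (no rank/flattening measure); likewise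
RankLifting, ShiftedPartialsCannotSeparate, PartialDerivativesDetPerm, UnpaddedShiftedPartials,
FullRankMultilinear, DepthReductionChasm, DepthReductionChasmDepthFour, GCTOccurrenceObstructions,
GCTUsefulModules, GCTMatrixPowering, NotViaSaturations, KroneckerPlethysmHardness, MonotoneGap,
NoncommutativeExtensions — the route proves no algebraic lower bound.
- Uncatalogued, load-bearing: the constant problem itself (KoiranPerifel2011 Rem. 4;
Burgisser2000TCS p. 73). The route does not evade it; it splits it by places and bets that the
archimedean half reduces to a magnit

History (route lifecycle, newest last):
- 2026-08-15T16:18:24Z · rev 1: restated BoolHyp (stmt-ValiantsHypothesis-0346), Target (stmt-ValiantsHypothesis-5384) — route-repair (glue + staffability): deciding theorem `closes : TameNF → TameA3 → CoeffBoundA2 → BoolHyp → Assembly → ValiantsHypothesis` (pure application; nati (planner-rbadge-ValiantsHypothesis-NumTame-a76042c8-g2-0)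
- 2026-08-23T08:33:38Z · DORMANT — reconciler: no traction for 6 d (last activity statement-grounded at 2026-08-17T07:45:53Z); parked, not closed — `ledger route dormant route-ValiantsHypothesis- (operator:999:3172329)
- 2026-08-26T08:27:24Z · REACTIVATED — reconciler: reactivated — activity item-proof-filed at 2026-08-26T06:53:11Z after parking at 2026-08-23T08:33:38Z (operator:999:397760)
- 2026-09-03T05:49:56Z · DORMANT — reconciler: no traction for 5 d (last activity statement-checked at 2026-08-29T05:05:32Z); parked, not closed — `ledger route dormant route-ValiantsHypothesis-N (operator:999:219340)

sub-problem: ValiantsHypothesis · status: dormant · opened planner-plancard-ValiantsHypothesis-ValiantsH-b7b43fcf-0 2026-08-15T11:41:00Z · rev 1 · ledger route-ValiantsHypothesis-NumTame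
GENERATED by the gate from the ledger (D-0016/17). Provers cite these decls: `theorem foo : Summit.ValiantsHypothesis.ValiantsHypothesis.Theses.NumTame.<Decl> := …` in Summits/ValiantsHypothesis/ValiantsHypothesis/Theorems/<Name>.lean.
-/

namespace Summit.ValiantsHypothesis.ValiantsHypothesis.Theses.NumTame

open scoped BigOperators Topology Manifold Classical MeasureTheory ProbabilityTheory Matrix InnerProductSpace ComplexConjugate ContinuousMap
open Filter Set Function TopologicalSpace MeasureTheory

attribute [summit_statement] _root_.ValiantsHypothesis

open Literature.PNP

-- earlier Target (stmt-ValiantsHypothesis-5384, replaced 2026-08-15T16:18:24Z -> stmt-ValiantsHypothesis-10553): retired by None — (∃ c : ℕ, ∀ (n t : ℕ) (f : MvPolynomial (Fin n) ℂ), (∀ m, ‖MvPolynomial.coeff m f‖ ≤ (2 : ℝ) ^ t) → ∀ P : Literature.Computability.AlgebraicComplexity.ArithCircuit ℂ (Fin n), P.IsFanInTwo → P.Computes f → ∃ P' : Literature.Computability.AlgebraicComplexity.ArithCircuit ℂ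
/-- item stmt-ValiantsHypothesis-10553 · target · rank 0 · open · by planner
why it might fail: TameNF may be false (exact computation of some small-coefficient family could need doubly-exponential intermediate magnitudes), and NP ⊆ P/poly contradicts nothing known (Karp–Lipton only collapses PH).
sources: Burgisser2000TCS, arXiv:0710.0360, KarpLipton1980
[target] X = TameNF ∧ NP ⊄ P/poly (both conjuncts spelled out — the gate emits the rank-0 decl
before the crux decls; the Boolean conjunct as ¬ (Nondeterministic.NP ⊆ PPoly), definitionally
Literature.Computability.Complexity.NPNotSubsetPPoly; rev 1 so that no cite-only Literature Prop
sits in the cone). [difficulty: open-problem] -/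
@[route_item "route-ValiantsHypothesis-NumTame"]
def Target : Prop :=
  (∃ c : ℕ, ∀ (n t : ℕ) (f : MvPolynomial (Fin n) ℂ), (∀ m, ‖MvPolynomial.coeff m f‖ ≤ (2 : ℝ) ^ t) → ∀ P : Literature.Computability.AlgebraicComplexity.ArithCircuit ℂ (Fin n), P.IsFanInTwo → P.Computes f → ∃ P' : Literature.Computability.AlgebraicComplexity.ArithCircuit ℂ (Fin n), P'.Computes f ∧ P'.size ≤ (P.size + n + t + f.totalDegree) ^ c + c ∧ P'.IsFanInTwo ∧ (∀ g ∈ P'.gates, ∀ u ∈ Literature.Computability.AlgebraicComplexity.ArithCircuit.Gate.args g, ∀ a : ℂ, u = Literature.Computability.AlgebraicComplexity.ArithCircuit.Operand.const a → ‖a‖ ≤ (2 : ℝ) ^ ((P.size + n + t + f.totalDegree) ^ c + c)) ∧ (∀ args, Literature.Computability.AlgebraicComplexity.ArithCircuit.Gate.sum args ∈ P'.gates → ∀ a ∈ args, ‖a.1‖ ≤ (2 : ℝ) ^ ((P.size + n + t + f.totalDegree) ^ c + c)) ∧ (∀ a : ℂ, P'.output = Literature.Computability.AlgebraicComplexity.ArithCircuit.Operand.const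 a → ‖a‖ ≤ (2 : ℝ) ^ ((P.size + n + t + f.totalDegree) ^ c + c)) ∧ ∀ g ∈ Literature.Computability.AlgebraicComplexity.ArithCircuit.gateValues P'.gates, ∀ x : Fin n → Bool, ‖MvPolynomial.eval (Literature.Computability.AlgebraicComplexity.boolPoint ℂ x) g‖ ≤ (2 : ℝ) ^ ((P.size + n + t + f.totalDegree) ^ c + c)) ∧ ¬ (Literature.Computability.Complexity.Nondeterministic.NP ⊆ Literature.Computability.Complexity.PPoly)

/-- item stmt-ValiantsHypothesis-5385 · crux · rank 2 · open · by planner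
why it might fail: A family f_n (poly size/degree, 0/1 coefficients) whose every poly-size circuit must pass through cube-values 2^(2^(n^Ω(1))) ('cancellation is essential') refutes it; no such phenomenon is known, but no magnitude-reduction theorem exists either (KoiranPerifel2011 Rem. 4).
sources: arXiv:0710.0360, Burgisser2000TCS, doi:10.1006/jcss.1997.1478, Burgisser2009
[crux] cube-tame normal form: for some absolute c, every fan-in-two ℂ-circuit P computing f (n
variables, coefficients of modulus ≤ 2^t) can be replaced by a fan-in-two circuit computing f of
size ≤ N^c + c, N = |P| + n + t + deg f, all of whose constants, sum weights and gate values at 0/1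
points have modulus ≤ 2^(N^c + c) (card crux NumTame, exact-computation form). [difficulty:
open-problem] -/
@[route_item "route-ValiantsHypothesis-NumTame"]
def TameNF : Prop :=
  ∃ c : ℕ, ∀ (n t : ℕ) (f : MvPolynomial (Fin n) ℂ), (∀ m, ‖MvPolynomial.coeff m f‖ ≤ (2 : ℝ) ^ t) → ∀ P : Literature.Computability.AlgebraicComplexity.ArithCircuit ℂ (Fin n), P.IsFanInTwo → P.Computes f → ∃ P' : Literature.Computability.AlgebraicComplexity.ArithCircuit ℂ (Fin n), P'.Computes f ∧ P'.size ≤ (P.size + n + t + f.totalDegree) ^ c + c ∧ P'.IsFanInTwo ∧ (∀ g ∈ P'.gates, ∀ u ∈ Literature.Computability.AlgebraicComplexity.ArithCircuit.Gate.args g, ∀ a : ℂ, u = Literature.Computability.AlgebraicComplexity.ArithCircuit.Operand.const a → ‖a‖ ≤ (2 : ℝ) ^ ((P.size + n + t + f.totalDegree) ^ c + c)) ∧ (∀ args, Literature.Computability.AlgebraicComplexity.ArithCircuit.Gate.sum args ∈ P'.gates → ∀ a ∈ args, ‖a.1‖ ≤ (2 : ℝ) ^ ((P.size + n + t + f.totalDegree)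 ^ c + c)) ∧ (∀ a : ℂ, P'.output = Literature.Computability.AlgebraicComplexity.ArithCircuit.Operand.const a → ‖a‖ ≤ (2 : ℝ) ^ ((P.size + n + t + f.totalDegree) ^ c + c)) ∧ ∀ g ∈ Literature.Computability.AlgebraicComplexity.ArithCircuit.gateValues P'.gates, ∀ x : Fin n → Bool, ‖MvPolynomial.eval (Literature.Computability.AlgebraicComplexity.boolPoint ℂ x) g‖ ≤ (2 : ℝ) ^ ((P.size + n + t + f.totalDegree) ^ c + c)

/-- item stmt-ValiantsHypothesis-5386 · crux · rank 3 · closed · proved by Summit.ValiantsHypothesis.ValiantsHypothesis.Theorems.NumTame.tameA3_proof (prover) · by planner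
why it might fail: Forward error analysis (ε_j ≤ (2^(R+2))^(j+1)·2^(-B)) settles it unless the typed tameness misses a magnitude source — unbounded sum weights, output constant, or fan-in > 2 (all pinned in the Lean); formal cost: complex fixed-point arithmetic as B₂ programs.
sources: BlumCuckerShubSmale1998, doi:10.1137/070697926, doi:10.1137/s0097539794270340, Burgisser2000TCS
[crux] archimedean (A3), GRH-free: if φ_n : {0,1}^n → ℕ, φ_n < 2^t(n), t p-bounded, is computed on
the cube by fan-in-two ℂ-circuits of p-bounded size r(n) whose constants, sum weights and gate
cube-values have modulus ≤ 2^r(n), then the bits of φ_n have polynomial-size B₂-circuits (round a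
fixed-point simulation with O(r(n)·size) bits; constants become advice). [difficulty: L] -/
@[route_item "route-ValiantsHypothesis-NumTame"]
def TameA3 : Prop :=
  ∀ (φ : ∀ n, (Fin n → Bool) → ℕ) (t : ℕ → ℕ), Literature.Computability.AlgebraicComplexity.IsPBounded t → (∀ n x, φ n x < 2 ^ t n) → (∃ r : ℕ → ℕ, Literature.Computability.AlgebraicComplexity.IsPBounded r ∧ ∀ n, ∃ P : Literature.Computability.AlgebraicComplexity.ArithCircuit ℂ (Fin n), P.size ≤ r n ∧ P.IsFanInTwo ∧ (∀ g ∈ P.gates, ∀ u ∈ Literature.Computability.AlgebraicComplexity.ArithCircuit.Gate.args g, ∀ a : ℂ, u = Literature.Computability.AlgebraicComplexity.ArithCircuit.Operand.const a → ‖a‖ ≤ (2 : ℝ) ^ r n) ∧ (∀ args, Literature.Computability.AlgebraicComplexity.ArithCircuit.Gate.sum args ∈ P.gates → ∀ a ∈ args, ‖a.1‖ ≤ (2 : ℝ) ^ r n) ∧ (∀ a : ℂ, P.output = Literature.Computability.AlgebraicComplexity.ArithCircuit.Operand.const a → ‖a‖ ≤ (2 : ℝ) ^ r n) ∧ (∀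 g ∈ Literature.Computability.AlgebraicComplexity.ArithCircuit.gateValues P.gates, ∀ x : Fin n → Bool, ‖MvPolynomial.eval (Literature.Computability.AlgebraicComplexity.boolPoint ℂ x) g‖ ≤ (2 : ℝ) ^ r n) ∧ ∀ x : Fin n → Bool, MvPolynomial.eval (Literature.Computability.AlgebraicComplexity.boolPoint ℂ x) P.eval = (φ n x : ℂ)) → ∃ q : Polynomial ℕ, ∀ n, Literature.Computability.Complexity.CktSize Literature.Computability.Complexity.B2 (fun (x : Fin n → Bool) (i : Fin (t n)) => (φ n x).testBit i) (q.eval n)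

-- `TameA3` holds: proved by `Summit.ValiantsHypothesis.ValiantsHypothesis.Theorems.NumTame.tameA3_proof` (its module imports this route file, so no `_holds` link can be stated here).

/-- item stmt-ValiantsHypothesis-5387 · crux · rank 4 · open · by planner
why it might fail: Large constants may genuinely help: KoiranPerifel2011 Rem. 4 ('integer constants of exponential bit size') is open even for per; for a FIXED skeleton it is false (garbage gadgets force leaves y_(i+1) = y_i^D, |y_m| = 2^(D^m)), so any proof must restructure the circuit, not re-solve its constants.
sources: arXiv:0710.0360, KrickPardo1996, Burgisser2000TCS, Koiran2004
[crux] magnitude normal form (algebraic strengthening of TameNF): same hypotheses, and the new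
circuit has size and ALL gate formal degrees ≤ N^c + c and all constants / sum weights of modulus ≤
2^(N^c + c) (arbitrary complex constants allowed; only their size is bounded). Implies TameNF by the
growth lemma |g_j| ≤ 2^((R+1)·fdeg_j·(j+2)). [difficulty: open-problem] -/
@[route_item "route-ValiantsHypothesis-NumTame"]
def MagnitudeNF : Prop :=
  ∃ c : ℕ, ∀ (n t : ℕ) (f : MvPolynomial (Fin n) ℂ), (∀ m, ‖MvPolynomial.coeff m f‖ ≤ (2 : ℝ) ^ t) → ∀ P : Literature.Computability.AlgebraicComplexity.ArithCircuit ℂ (Fin n), P.IsFanInTwo → P.Computes f → ∃ P' : Literature.Computability.AlgebraicComplexity.ArithCircuit ℂ (Fin n), P'.Computes f ∧ P'.size ≤ (P.size + n + t + f.totalDegree) ^ c + c ∧ P'.IsFanInTwo ∧ (∀ d ∈ Literature.Computability.AlgebraicComplexity.ArithCircuit.gateFormalDegrees P'.gates, d ≤ (P.size + n + t + f.totalDegree) ^ c + c) ∧ (∀ d ∈ Literature.Computability.AlgebraicComplexity.ArithCircuit.gateFormalDegrees P'.gates, 1 ≤ d) ∧ (∀ g ∈ P'.gates, ∀ u ∈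 Literature.Computability.AlgebraicComplexity.ArithCircuit.Gate.args g, ∀ a : ℂ, u = Literature.Computability.AlgebraicComplexity.ArithCircuit.Operand.const a → ‖a‖ ≤ (2 : ℝ) ^ ((P.size + n + t + f.totalDegree) ^ c + c)) ∧ (∀ args, Literature.Computability.AlgebraicComplexity.ArithCircuit.Gate.sum args ∈ P'.gates → ∀ a ∈ args, ‖a.1‖ ≤ (2 : ℝ) ^ ((P.size + n + t + f.totalDegree) ^ c + c)) ∧ ∀ a : ℂ, P'.output = Literature.Computability.AlgebraicComplexity.ArithCircuit.Operand.const a → ‖a‖ ≤ (2 : ℝ) ^ ((P.size + n + t + f.totalDegree) ^ c + c)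

/-- item stmt-ValiantsHypothesis-6383 · support · rank 5 · open · by planner
[crux] HEIGHT NORMAL FORM (arithmetic strengthening of MagnitudeNF; the card's 'poly-height
constants via arithmetic Bezout + Bilu' made precise and quantified over circuits, not over the
constants variety of one skeleton): for some absolute c, every fan-in-two C-circuit P computing f in
Z[x_1..x_n] (coefficients of modulus <= 2^t, degree d) can be replaced by a fan-in-two circuit
computing f of size and all gate formal degrees <= N^c + c (N = |P| + n + t + d) whose constants and
sum weights are ALGEBRAIC numbers kappa_j in a common number field K with archimedean height
prod_{sigma: K -> C} max(1,|sigma kappa_j|) <= 2^((N^c + c) [K:Q]) — the DEGREE [K:Q] is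
unrestricted (may be 2^poly). With EmbeddingChoice (stmt-ValiantsHypothesis-5390) and
Galois-conjugation of circuits (P.map sigma computes f again since f has rational coefficients) it
implies MagnitudeNF for integer polynomials, hence TameNF. Why it might fail: arithmetic Bezout
(KrickPardo1996; Burgisser2000TCS Thm 4.5, tree algebraicSolution_height_bound) only gives
log-height 2^poly for SOME solution of a FIXED skeleton, and for a fixed skeleton poly height is
false (garbage leaves y_{i+1} = y_i^D force height D^m); trading -/
@[route_item "route-ValiantsHypothesis-NumTame"]
def HeightNF : Prop :=
  ∃ c : ℕ, ∀ (n t : ℕ) (f : MvPolynomial (Fin n) ℂ), (∀ m, ∃ z : ℤ, MvPolynomial.coeff m f = z ∧ |(z : ℝ)| ≤ (2 : ℝ) ^ t) → ∀ P : Literature.Computability.AlgebraicComplexity.ArithCircuit ℂ (Fin n), P.IsFanInTwo → P.Computes f → ∃ (K : Type) (_ : Field K) (_ : NumberField K) (ι : K →+* ℂ) (P' : Literature.Computability.AlgebraicComplexity.ArithCircuit ℂ (Fin n)), P'.Computes f ∧ P'.size ≤ (P.size + n + t + f.totalDegree) ^ c + c ∧ P'.IsFanInTwo ∧ (∀ g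 ∈ P'.gates, 1 ≤ Literature.Computability.AlgebraicComplexity.ArithCircuit.Gate.fanIn g) ∧ (∀ d ∈ Literature.Computability.AlgebraicComplexity.ArithCircuit.gateFormalDegrees P'.gates, d ≤ (P.size + n + t + f.totalDegree) ^ c + c) ∧ (∀ g ∈ P'.gates, ∀ u ∈ Literature.Computability.AlgebraicComplexity.ArithCircuit.Gate.args g, ∀ a : ℂ, u = Literature.Computability.AlgebraicComplexity.ArithCircuit.Operand.const a → ∃ κ : K, ι κ = a ∧ ∏ σ : K →+* ℂ, max 1 ‖σ κ‖ ≤ (2 : ℝ) ^ (((P.size + n + t + f.totalDegree) ^ c + c) * Module.finrank ℚ K)) ∧ (∀ args, Literature.Computability.AlgebraicComplexity.ArithCircuit.Gate.sum args ∈ P'.gates → ∀ a ∈ args, ∃ κ : K, ι κ = a.1 ∧ ∏ σ : K →+* ℂ, max 1 ‖σ κ‖ ≤ (2 : ℝ) ^ (((P.size + n + t + f.totalDegree) ^ c + c) * Module.finrank ℚ K)) ∧ (∀ a : ℂ, P'.output = Literature.Computability.AlgebraicComplexity.ArithCircuit.Operand.const a → ∃ κ : K, ι κ = a ∧ ∏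 σ : K →+* ℂ, max 1 ‖σ κ‖ ≤ (2 : ℝ) ^ (((P.size + n + t + f.totalDegree) ^ c + c) * Module.finrank ℚ K))

-- earlier BoolHyp (stmt-ValiantsHypothesis-0346, replaced 2026-08-15T16:18:24Z -> stmt-ValiantsHypothesis-10552): retired by None — Literature.Computability.Complexity.NPNotSubsetPPoly
/-- item stmt-ValiantsHypothesis-10552 · support · rank 9 · open · by planner
sources: CookClay2006, KarpLipton1980, Burgisser2000TCS
[support] NP ⊄ P/poly stated inline: ¬ (Nondeterministic.NP ⊆ PPoly), definitionally (Iff.rfl)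
Literature.Computability.Complexity.NPNotSubsetPPoly (posed in Cook's Clay problem description §3;
its failure collapses PH by Karp–Lipton). The OPEN Boolean hypothesis that Bürgisser's transfer
consumes, registered as this route's own obligation (D-0027: open conjectures are route items, not
cite-only Literature IOUs in the cone); same content as route BoolTransfer's BoolHyp
(stmt-ValiantsHypothesis-0346) and PneNP's CircuitThesis; harder than P ≠ NP and not expected to
receive prover time from this route. [difficulty: open-problem] -/
@[route_item "route-ValiantsHypothesis-NumTame"]
def BoolHyp : Prop :=
  ¬ (Literature.Computability.Complexity.Nondeterministic.NP ⊆ Literature.Computability.Complexity.PPoly)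

/-- item stmt-ValiantsHypothesis-5388 · support · rank 9 · open · by planner
sources: Burgisser2009, Burgisser2000
[support] MagnitudeNF → TameNF: with fan-in two, constants and weights ≤ 2^R and all gate formal
degrees ≤ D, every gate value on the cube is ≤ 2^((R+1)·D·(s+2)) (induction over the gate list).
[difficulty: provable-now] -/
@[route_item "route-ValiantsHypothesis-NumTame"]
def MagnitudeGlue : Prop :=
  MagnitudeNF → TameNF

/-- item stmt-ValiantsHypothesis-5389 · support · rank 9 · closed · proved by Summit.ValiantsHypothesis.ValiantsHypothesis.Theorems.NumTame.coeffBoundA2_proof (prover) · by planner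
sources: Burgisser2000TCS, Burgisser2000
[support] Bürgisser's (A2) over ℂ with bounds exported: every NP language has a p-definable family
with a Boolean part deciding it by positivity, whose degrees are ≤ r(n) and coefficients of modulus
≤ 2^r(n), r p-bounded (re-run Part II of BurgisserBooleanParts: products of ≤ poly EQ/table
polynomials with O(1) coefficients). [difficulty: M] -/
@[route_item "route-ValiantsHypothesis-NumTame"]
def CoeffBoundA2 : Prop :=
  ∀ L ∈ Literature.Computability.Complexity.Nondeterministic.NP, ∃ (f : ∀ n, MvPolynomial (Fin n) ℂ) (φ : ∀ n, (Fin n → Bool) → ℕ) (t : ℕ → ℕ), Literature.Computability.AlgebraicComplexity.IsVNPFamily f ∧ Literature.Computability.AlgebraicComplexity.IsBooleanPart ℂ f φ t ∧ (∀ n (x : Fin n → Bool), List.ofFn x ∈ L ↔ 0 < φ n x) ∧ ∃ r : ℕ → ℕ, Literature.Computability.AlgebraicComplexity.IsPBounded r ∧ ∀ n, (f n).totalDegree ≤ r n ∧ ∀ m, ‖MvPolynomial.coeff m (f n)‖ ≤ (2 : ℝ) ^ r n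

-- `CoeffBoundA2` holds: proved by `Summit.ValiantsHypothesis.ValiantsHypothesis.Theorems.NumTame.coeffBoundA2_proof` (its module imports this route file, so no `_holds` link can be stated here).

/-- item stmt-ValiantsHypothesis-5390 · support · rank 9 · closed · proved by Summit.ValiantsHypothesis.ValiantsHypothesis.Theorems.NumTame.embeddingChoice_proof (prover) · by planner
sources: doi:10.1215/S0012-7094-97-08921-3, Burgisser2000TCS
[support] pigeonhole over conjugate embeddings (the 'Bilu/averaging' half of the card, no
equidistribution needed): if m elements of a number field K have archimedean height products ∏_σ
max(1,|σκ_j|) ≤ 2^(H·[K:ℚ]), some embedding σ : K → ℂ makes ALL |σ κ_j| ≤ 2^(mH+1); with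
Galois-invariance of 'P computes f ∈ ℚ[x]' this turns poly-height constants of ANY degree into small
ones. [difficulty: provable-now] -/
@[route_item "route-ValiantsHypothesis-NumTame"]
def EmbeddingChoice : Prop :=
  ∀ (K : Type) [Field K] [NumberField K] (m H : ℕ) (κ : Fin m → K), (∀ j, ∏ σ : K →+* ℂ, max 1 ‖σ (κ j)‖ ≤ (2 : ℝ) ^ (H * Module.finrank ℚ K)) → ∃ σ : K →+* ℂ, ∀ j, ‖σ (κ j)‖ ≤ (2 : ℝ) ^ (m * H + 1)

-- `EmbeddingChoice` holds: proved by `Summit.ValiantsHypothesis.ValiantsHypothesis.Theorems.NumTame.embeddingChoice_proof` (its module imports this route file, so no `_holds` link can be stated here).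

/-- item stmt-ValiantsHypothesis-5391 · support · rank 9 · open · by planner
sources: Burgisser2000TCS, Burgisser2000, Koiran1996
[support] the finite-place twin, GRH-free: if φ_n is computed on the cube by fan-in-two ℂ-circuits
of p-bounded size whose constants are algebraic INTEGERS lying in a subfield K_n ⊂ ℂ with [K_n:ℚ] ≤
r(n), then the bits of φ_n have polynomial-size circuits (simulate in O_K/𝔭 = F_(p^f), f ≤ [K_n:ℚ],
p a Bertrand prime > 2^t(n); residues are advice; no Chebotarev, heights irrelevant; integrality is
needed — a free constant 1/N with N divisible by all small primes kills every small p). [difficulty: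
L] -/
@[route_item "route-ValiantsHypothesis-NumTame"]
def LowDegreeRegime : Prop :=
  ∀ (φ : ∀ n, (Fin n → Bool) → ℕ) (t : ℕ → ℕ), Literature.Computability.AlgebraicComplexity.IsPBounded t → (∀ n x, φ n x < 2 ^ t n) → (∃ r : ℕ → ℕ, Literature.Computability.AlgebraicComplexity.IsPBounded r ∧ ∀ n, ∃ (K : IntermediateField ℚ ℂ) (P : Literature.Computability.AlgebraicComplexity.ArithCircuit ℂ (Fin n)), FiniteDimensional ℚ K ∧ Module.finrank ℚ K ≤ r n ∧ P.size ≤ r n ∧ P.IsFanInTwo ∧ (∀ g ∈ P.gates, ∀ u ∈ Literature.Computability.AlgebraicComplexity.ArithCircuit.Gate.args g, ∀ a : ℂ, u = Literature.Computability.AlgebraicComplexity.ArithCircuit.Operand.const a → a ∈ K ∧ IsIntegral ℤ a) ∧ (∀ args, Literature.Computability.AlgebraicComplexity.ArithCircuit.Gate.sum args ∈ P.gates → ∀ a ∈ args, a.1 ∈ K ∧ IsIntegral ℤ a.1) ∧ (∀ a : ℂ, P.output = Literature.Computability.AlgebraicComplexity.ArithCircuit.Operand.const a → a ∈ K ∧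 IsIntegral ℤ a) ∧ ∀ x : Fin n → Bool, MvPolynomial.eval (Literature.Computability.AlgebraicComplexity.boolPoint ℂ x) P.eval = (φ n x : ℂ)) → ∃ q : Polynomial ℕ, ∀ n, Literature.Computability.Complexity.CktSize Literature.Computability.Complexity.B2 (fun (x : Fin n → Bool) (i : Fin (t n)) => (φ n x).testBit i) (q.eval n)

/-- item stmt-ValiantsHypothesis-5392 · assembly · rank 1 · closed · proved by Summit.ValiantsHypothesis.ValiantsHypothesis.Theorems.NumTame.assembly_proof (prover) · by planner
sources: Burgisser2000TCS, Burgisser2000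
[assembly] TameNF → TameA3 → CoeffBoundA2 → BoolHyp → ValiantsHypothesis. -/
@[route_item "route-ValiantsHypothesis-NumTame"]
def Assembly : Prop :=
  TameNF → TameA3 → CoeffBoundA2 → BoolHyp → ValiantsHypothesis

-- `Assembly` holds: proved by `Summit.ValiantsHypothesis.ValiantsHypothesis.Theorems.NumTame.assembly_proof` (its module imports this route file, so no `_holds` link can be stated here).

/-! D-0027 §2.1 — DECIDING THEOREM (planner-authored via `route open/edit --closes-file`; by planner-rbadge-ValiantsHypothesis-NumTame-a76042c8-g2-0 2026-08-15T16:18:24Z):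
its hypotheses are this route's items and its conclusion the sub-problem Statement (glue_lint), and it elaborates with this file. -/

@[closes "route-ValiantsHypothesis-NumTame"] theorem closes (hTameNF : TameNF) (hTameA3 : TameA3) (hCoeffBoundA2 : CoeffBoundA2) (hBoolHyp : BoolHyp)
    (hAssembly : Assembly) : _root_.ValiantsHypothesis :=
  hAssembly hTameNF hTameA3 hCoeffBoundA2 hBoolHyp

end Summit.ValiantsHypothesis.ValiantsHypothesis.Theses.NumTame
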